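import Summits.FinalStateConjecture.FinalStateConjecture.Theorems.SwallowTheDatumKerrShieldedSettlesStubScriTransportAux
import Literature.Geometry.Lorentzian.MinkowskiGlobalHyperbolicity
import Literature.Geometry.Lorentzian.CausalityPushUp
import Literature.Geometry.Lorentzian.KerrHorizonCausality
import HarnessLib

/-!
# `KerrShieldedSettles`, line `tapered-temporal-collar` — stub S7 `stub_exteriorTransport`, part 1:
# pushing `J^±`/`I^±` through the chart map, and the horizon barrier

Support file for crux `stmt-FinalStateConjecture-10054`
(`Summit.FinalStateConjecture.FinalStateConjecture.Theses.SwallowTheDatum.KerrShieldedSettles`), stub S7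
`stub_exteriorTransport` (push the Kerr-side final-state decomposition of `O_K = {r > r₊, x⁰ ≥ T(r)}` through
the chart map `χ` of the tapered collar `W = {0 < x⁰ − T(r) + (r − r₁)/4}` into a vacuum Cauchy development and
identify the self-determined exterior region by the last-exit argument).  This part proves:

* `ExteriorTransport.image_causalFuture_subset_of_le`, `image_chronologicalFuture_subset_of_le` —
  `χ(J⁺_K(S)) ⊆ J⁺(χ S)` and `χ(I⁺_K(S)) ⊆ I⁺(χ S)` for every `S ⊆ {x⁰ ≥ T(r)}` (the connecting curves stay in
  `W` by the causal `u`-clock of the sibling file `…StubScriTransportAux`, where `χ` is differentiable,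
  isometric and oriented); and the pointwise past versions `mem_causalPast_image_of_le`,
  `mem_chronologicalPast_image_of_le` (`x ∈ J⁻_K(S)`, `x⁰ ≥ T(r x)` ⟹ `χ x ∈ J⁻(χ S)`) by time duality;
* `ExteriorTransport.radius_gt_of_le` (registered sub-goal `stub_exteriorTransportBarrier`) — **the horizon
  barrier**: a future timelike curve of the ingoing Kerr–Schild chart which ends in the exterior `{r > r₊}` was
  in the exterior at all earlier parameters (the covector `dt* − (4M/(r − r₊)) dr` is timelike and
  co-oriented, `CollarCauchy.clock_pos`, so `(r − r₊)·exp(−t*/(4M))` decreases along the curve while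
  `r > r₊`; Dafermos–Rodnianski–Shlapentokh-Rothman arXiv:1402.7034, §2.2.5).

References: B. O'Neill, *Semi-Riemannian geometry* (1983), Ch. 5, Lemma 5.29, Ch. 14, pp. 402–403;
M. Dafermos, I. Rodnianski, Y. Shlapentokh-Rothman, arXiv:1402.7034, §2.2.5; M. Dafermos, I. Rodnianski,
arXiv:0811.0354, §5.1.
-/

set_option linter.dupNamespace false

noncomputable section

open Set Filter Function
open scoped Manifold ContDiff Topology
open Literature.Geometry.Lorentzian
open Summit.FinalStateConjecture.FinalStateConjecture.Theorems.KerrShieldedDataExist.Negative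
  (bentHeight mass_pos)

namespace Summit.FinalStateConjecture.FinalStateConjecture.Theorems.SwallowTheDatum.KerrShieldedSettles

namespace ExteriorTransport

/-! ## Pushing `J⁺`, `I⁺`, `J⁻`, `I⁻` through the chart map on `{x⁰ ≥ T(r)}` -/

section Push

variable [Kerr.Facts] {M a r₁ : ℝ}
  {N : Type*} [TopologicalSpace N] [ChartedSpace E4 N] [IsManifold (𝓡 4) ∞ N]
  {g : LorentzianMetric (𝓡 4) ∞ N} {τ : TimeOrientation g} {χ : Kerr.region a r₁ → N}

/-- **`χ(J⁺_K(S)) ⊆ J⁺(χ(S))` for `S ⊆ {x⁰ ≥ T(r)}`**: the chart map is differentiable with cone-preserving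
differential on the collar `W` (`ScriTransport.isFutureDirected_mfderiv_of_iso`), and future causal chart curves
issuing from `{u ≥ 0}` stay in `W` (`ScriTransport.curve_mem_collar`). O'Neill 1983, Ch. 14, pp. 402–403.
[cite: ONeill1983, Ch. 14, pp. 402–403] -/
theorem image_causalFuture_subset_of_le (hM0 : 0 < M) (hM : 0 ≤ M) (ha : |a| < M)
    (hχs : ContMDiffOn 𝓘(ℝ, E4) (𝓡 4) ∞ χ
      {x | 0 < (x : E4) 0 - bentHeight M a (Kerr.radius a (x : E4)) + (Kerr.radius a (x : E4) - r₁) / 4})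
    (hχg : ∀ x : Kerr.region a r₁, 0 < (x : E4) 0 - bentHeight M a (Kerr.radius a (x : E4)) +
          (Kerr.radius a (x : E4) - r₁) / 4 →
        (∀ v w : E4, g.val (χ x) (mfderiv 𝓘(ℝ, E4) (𝓡 4) χ x v)
            (mfderiv 𝓘(ℝ, E4) (𝓡 4) χ x w) = Kerr.bilin M a (x : E4) v w) ∧
        g.val (χ x) (τ.vectorField (χ x))
            (mfderiv 𝓘(ℝ, E4) (𝓡 4) χ x (Kerr.timeVector M a (x : E4))) < 0)
    {S : Set (Kerr.region a r₁)} (hS : ∀ x ∈ S, bentHeight M a (Kerr.radius a (x : E4)) ≤ (x : E4) 0) :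
    χ '' (Kerr.smoothMetric M a r₁).causalFuture ((Kerr.timeOrientation M a r₁ hM).ofLE le_top) S ⊆
      g.causalFuture τ (χ '' S) := by
  refine ScriTransport.image_causalFuture_subset
    (τN := (Kerr.timeOrientation M a r₁ hM).ofLE le_top) (τ := τ) (f := χ)
    (O := {x : Kerr.region a r₁ | 0 < (x : E4) 0 - bentHeight M a (Kerr.radius a (x : E4)) +
      (Kerr.radius a (x : E4) - r₁) / 4}) (S := S) (fun x hx ↦ ⟨?_, fun v hv ↦ ?_⟩) ?_
  · exact ((hχs x hx).contMDiffAt ((CollarEmbedsMGHD.collar M a r₁ hM0).isOpen.mem_nhds hx)).mdifferentiableAt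
      (by simp)
  · exact ScriTransport.isFutureDirected_mfderiv_of_iso hM (hχg x hx).1 (hχg x hx).2 hv
  · intro c b₁ b₂ hb hc h0 t ht
    exact ScriTransport.curve_mem_collar ha ordConnected_Icc hc (left_mem_Icc.2 hb.le) (hS _ h0) ht ht.1

/-- **`χ(I⁺_K(S)) ⊆ I⁺(χ(S))` for `S ⊆ {x⁰ ≥ T(r)}`** (timelike version of
`image_causalFuture_subset_of_le`: the differential is isometric on `W`, so timelike velocities stay
timelike). O'Neill 1983, Ch. 14, pp. 402–403. [cite: ONeill1983, Ch. 14, pp. 402–403] -/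
theorem image_chronologicalFuture_subset_of_le (hM0 : 0 < M) (hM : 0 ≤ M) (ha : |a| < M)
    (hχs : ContMDiffOn 𝓘(ℝ, E4) (𝓡 4) ∞ χ
      {x | 0 < (x : E4) 0 - bentHeight M a (Kerr.radius a (x : E4)) + (Kerr.radius a (x : E4) - r₁) / 4})
    (hχg : ∀ x : Kerr.region a r₁, 0 < (x : E4) 0 - bentHeight M a (Kerr.radius a (x : E4)) +
          (Kerr.radius a (x : E4) - r₁) / 4 →
        (∀ v w : E4, g.val (χ x) (mfderiv 𝓘(ℝ, E4) (𝓡 4) χ x v)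
            (mfderiv 𝓘(ℝ, E4) (𝓡 4) χ x w) = Kerr.bilin M a (x : E4) v w) ∧
        g.val (χ x) (τ.vectorField (χ x))
            (mfderiv 𝓘(ℝ, E4) (𝓡 4) χ x (Kerr.timeVector M a (x : E4))) < 0)
    {S : Set (Kerr.region a r₁)} (hS : ∀ x ∈ S, bentHeight M a (Kerr.radius a (x : E4)) ≤ (x : E4) 0) :
    χ '' (Kerr.smoothMetric M a r₁).chronologicalFuture ((Kerr.timeOrientation M a r₁ hM).ofLE le_top) S ⊆
      g.chronologicalFuture τ (χ '' S) := by
  rintro _ ⟨q, ⟨p, hp, γ, b₁, b₂, hb, hγ, hγa, hγb⟩, rfl⟩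
  refine ⟨χ p, mem_image_of_mem χ hp, χ ∘ γ, b₁, b₂, hb, fun t ht ↦ ?_, by simp [hγa], by simp [hγb]⟩
  have hmem : 0 < (γ t : E4) 0 - bentHeight M a (Kerr.radius a (γ t : E4)) +
      (Kerr.radius a (γ t : E4) - r₁) / 4 :=
    ScriTransport.curve_mem_collar ha ordConnected_Icc hγ.isFutureCausalCurveOn (left_mem_Icc.2 hb.le)
      (by rw [hγa]; exact hS p hp) ht ht.1
  obtain ⟨hd, htl, hfd⟩ := hγ t ht
  have hχd : MDifferentiableAt 𝓘(ℝ, E4) (𝓡 4) χ (γ t) :=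
    ((hχs _ hmem).contMDiffAt ((CollarEmbedsMGHD.collar M a r₁ hM0).isOpen.mem_nhds hmem)).mdifferentiableAt
      (by simp)
  have hvel : velocity (𝓡 4) (χ ∘ γ) t = mfderiv 𝓘(ℝ, E4) (𝓡 4) χ (γ t) (velocity 𝓘(ℝ, E4) γ t) := by
    unfold velocity
    rw [mfderiv_comp t hχd hd]
    rfl
  refine ⟨hχd.comp t hd, ?_, ?_⟩
  · change g.val (χ (γ t)) (velocity (𝓡 4) (χ ∘ γ) t) (velocity (𝓡 4) (χ ∘ γ) t) < 0
    rw [hvel, (hχg _ hmem).1]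
    exact htl
  · rw [hvel]
    exact ScriTransport.isFutureDirected_mfderiv_of_iso hM (hχg _ hmem).1 (hχg _ hmem).2 hfd

/-- **Pointwise push of `J⁻`**: if `x ∈ J⁻_K(S)` and `x⁰ ≥ T(r x)`, then `χ x ∈ J⁻(χ(S))` (time duality
`x ∈ J⁻(p) ↔ p ∈ J⁺(x)` on both sides and `image_causalFuture_subset_of_le` for `{x}`). O'Neill 1983, Ch. 14,
pp. 402–403. [cite: ONeill1983, Ch. 14, pp. 402–403] -/
theorem mem_causalPast_image_of_le (hM0 : 0 < M) (hM : 0 ≤ M) (ha : |a| < M)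
    (hχs : ContMDiffOn 𝓘(ℝ, E4) (𝓡 4) ∞ χ
      {x | 0 < (x : E4) 0 - bentHeight M a (Kerr.radius a (x : E4)) + (Kerr.radius a (x : E4) - r₁) / 4})
    (hχg : ∀ x : Kerr.region a r₁, 0 < (x : E4) 0 - bentHeight M a (Kerr.radius a (x : E4)) +
          (Kerr.radius a (x : E4) - r₁) / 4 →
        (∀ v w : E4, g.val (χ x) (mfderiv 𝓘(ℝ, E4) (𝓡 4) χ x v)
            (mfderiv 𝓘(ℝ, E4) (𝓡 4) χ x w) = Kerr.bilin M a (x : E4) v w) ∧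
        g.val (χ x) (τ.vectorField (χ x))
            (mfderiv 𝓘(ℝ, E4) (𝓡 4) χ x (Kerr.timeVector M a (x : E4))) < 0)
    {S : Set (Kerr.region a r₁)} {x : Kerr.region a r₁}
    (hx : bentHeight M a (Kerr.radius a (x : E4)) ≤ (x : E4) 0)
    (h : x ∈ (Kerr.smoothMetric M a r₁).causalPast ((Kerr.timeOrientation M a r₁ hM).ofLE le_top) S) :
    χ x ∈ g.causalPast τ (χ '' S) := by
  rw [LorentzianMetric.causalPast, LorentzianMetric.causalFuture_eq_biUnion] at h
  simp only [mem_iUnion, exists_prop] at h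
  obtain ⟨p, hp, hxp⟩ := h
  have hpx : p ∈ (Kerr.smoothMetric M a r₁).causalFuture ((Kerr.timeOrientation M a r₁ hM).ofLE le_top) {x} := by
    have h1 := LorentzianMetric.mem_causalPast_of_mem_causalFuture hxp
    rwa [LorentzianMetric.causalPast_reverse] at h1
  have h1 := image_causalFuture_subset_of_le hM0 hM ha hχs hχg (S := {x}) (by simpa using hx)
    (mem_image_of_mem χ hpx)
  rw [image_singleton] at h1
  have h2 : χ x ∈ g.causalPast τ {χ p} := LorentzianMetric.mem_causalPast_of_mem_causalFuture h1
  exact LorentzianMetric.causalFuture_mono (singleton_subset_iff.2 (mem_image_of_mem χ hp)) h2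

/-- **Pointwise push of `I⁻`**: if `x ∈ I⁻_K(S)` and `x⁰ ≥ T(r x)`, then `χ x ∈ I⁻(χ(S))`. O'Neill 1983,
Ch. 14, pp. 402–403. [cite: ONeill1983, Ch. 14, pp. 402–403] -/
theorem mem_chronologicalPast_image_of_le (hM0 : 0 < M) (hM : 0 ≤ M) (ha : |a| < M)
    (hχs : ContMDiffOn 𝓘(ℝ, E4) (𝓡 4) ∞ χ
      {x | 0 < (x : E4) 0 - bentHeight M a (Kerr.radius a (x : E4)) + (Kerr.radius a (x : E4) - r₁) / 4})
    (hχg : ∀ x : Kerr.region a r₁, 0 < (x : E4) 0 - bentHeight M a (Kerr.radius a (x : E4)) +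
          (Kerr.radius a (x : E4) - r₁) / 4 →
        (∀ v w : E4, g.val (χ x) (mfderiv 𝓘(ℝ, E4) (𝓡 4) χ x v)
            (mfderiv 𝓘(ℝ, E4) (𝓡 4) χ x w) = Kerr.bilin M a (x : E4) v w) ∧
        g.val (χ x) (τ.vectorField (χ x))
            (mfderiv 𝓘(ℝ, E4) (𝓡 4) χ x (Kerr.timeVector M a (x : E4))) < 0)
    {S : Set (Kerr.region a r₁)} {x : Kerr.region a r₁}
    (hx : bentHeight M a (Kerr.radius a (x : E4)) ≤ (x : E4) 0)
    (h : x ∈ (Kerr.smoothMetric M a r₁).chronologicalPast ((Kerr.timeOrientation M a r₁ hM).ofLE le_top) S) :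
    χ x ∈ g.chronologicalPast τ (χ '' S) := by
  rw [LorentzianMetric.chronologicalPast, LorentzianMetric.chronologicalFuture_eq_biUnion] at h
  simp only [mem_iUnion, exists_prop] at h
  obtain ⟨p, hp, hxp⟩ := h
  have hpx : p ∈ (Kerr.smoothMetric M a r₁).chronologicalFuture
      ((Kerr.timeOrientation M a r₁ hM).ofLE le_top) {x} :=
    LorentzianMetric.mem_chronologicalFuture_of_mem_chronologicalPast hxp
  have h1 := image_chronologicalFuture_subset_of_le hM0 hM ha hχs hχg (S := {x}) (by simpa using hx)
    (mem_image_of_mem χ hpx)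
  rw [image_singleton] at h1
  have h2 : χ x ∈ g.chronologicalPast τ {χ p} :=
    LorentzianMetric.mem_chronologicalPast_of_mem_chronologicalFuture h1
  exact LorentzianMetric.chronologicalFuture_mono (singleton_subset_iff.2 (mem_image_of_mem χ hp)) h2

end Push

/-! ## The horizon barrier: future timelike curves ending in `{r > r₊}` were always in `{r > r₊}` -/

section Barrier

variable {M a : ℝ}

/-- **Numerator of the horizon clock**: at a point with `r > r₊` the covector `dt* − c dr` with the slope
`c = 4M/(r − r₊)` is timelike, `−Σ + c²(r² + a²) − 2Mr(1 + c)² < 0` (`Δ ≤ r(r − r₊)` in the exterior,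
`Kerr.delta_le_mul_sub_rPlus`, gives `c²Δ ≤ 4Mcr`, and `r² ≤ Σ`). Dafermos–Rodnianski–Shlapentokh-Rothman
arXiv:1402.7034, §2.2.5. [cite: DafermosRodnianskiShlapentokhrothman2014, §2.2.5] -/
theorem numerator_horizon_neg (ha : |a| < M) {x : E4} (hx : 0 < Kerr.radius a x)
    (hr : Kerr.rPlus M a < Kerr.radius a x) :
    -Kerr.blSigma a (E4.spatial x) + (4 * M / (Kerr.radius a x - Kerr.rPlus M a)) ^ 2 *
        (Kerr.radius a x ^ 2 + a ^ 2) -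
      2 * M * Kerr.radius a x * (1 + 4 * M / (Kerr.radius a x - Kerr.rPlus M a)) ^ 2 < 0 := by
  have hM := mass_pos ha
  have hSig := CollarCauchy.sq_le_blSigma_spatial hx
  have hΔ := Kerr.delta_le_mul_sub_rPlus ha hr
  set r := Kerr.radius a x with hr_def
  set ρ := r - Kerr.rPlus M a with hρ
  have hρpos : 0 < ρ := sub_pos.2 hr
  set c := 4 * M / ρ with hc
  have hcpos : 0 < c := div_pos (by linarith) hρpos
  have hcρ : c * ρ = 4 * M := div_mul_cancel₀ _ hρpos.ne'
  have key : c ^ 2 * (r ^ 2 - 2 * M * r + a ^ 2) ≤ 4 * M * c * r := by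
    calc c ^ 2 * (r ^ 2 - 2 * M * r + a ^ 2) ≤ c ^ 2 * (r * ρ) :=
          mul_le_mul_of_nonneg_left hΔ (sq_nonneg c)
      _ = c * r * (c * ρ) := by ring
      _ = 4 * M * c * r := by rw [hcρ]; ring
  have hMr : 0 < M * r := mul_pos hM hx
  nlinarith [key, hSig, hMr, sq_nonneg r]

variable [Kerr.Facts] {r₁ : ℝ} {hM : 0 ≤ M} {γ : ℝ → Kerr.region a r₁} {s : Set ℝ}

/-- **The horizon barrier** (registered sub-goal `stub_exteriorTransportBarrier`).  Along a future timelike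
curve `γ` of the ingoing Kerr–Schild chart on an interval `s`, if `r(γ t₁) > r₊` then `r(γ t) > r₊` for every
earlier parameter `t ≤ t₁` of `s`: otherwise let `t₂ < t₁` be the last parameter with `r ≤ r₊`; on `(t₂, t₁]`
the function `(r − r₊)·exp(−t*/(4M))` has negative derivative (`CollarCauchy.clock_pos` with the slope
`4M/(r − r₊)` of `numerator_horizon_neg`: `4M ṙ < (r − r₊) ṫ*`), so it is larger at `t₂` than at `t₁`, where it is
positive — contradicting `r(γ t₂) ≤ r₊`.  This is "past-directed causal curves from the exterior do not reach
`𝓗⁺` at finite `t*`" (Dafermos–Rodnianski–Shlapentokh-Rothman arXiv:1402.7034, §2.2.5).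
[cite: DafermosRodnianskiShlapentokhrothman2014, §2.2.5] -/
theorem radius_gt_of_le (ha : |a| < M) (hs : s.OrdConnected)
    (hγ : (Kerr.smoothMetric M a r₁).IsFutureTimelikeCurveOn
      ((Kerr.timeOrientation M a r₁ hM).ofLE le_top) γ s)
    {t₁ : ℝ} (ht₁ : t₁ ∈ s) (hr₁ : Kerr.rPlus M a < Kerr.radius a (γ t₁))
    {t : ℝ} (ht : t ∈ s) (htt : t ≤ t₁) :
    Kerr.rPlus M a < Kerr.radius a (γ t) := by
  by_contra hle
  push Not at hle
  have hM0 := mass_pos ha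
  have hrd : ∀ σ ∈ s, HasDerivAt (fun σ ↦ Kerr.radius a (γ σ))
      (Kerr.radiusGrad a (E4.spatial (γ σ : E4)) (E4.spatial (deriv (fun σ ↦ (γ σ : E4)) σ))) σ :=
    fun σ hσ ↦ CollarCauchy.hasDerivAt_radius_comp hγ hσ
  have htd : ∀ σ ∈ s, HasDerivAt (fun σ ↦ (γ σ : E4) 0) (deriv (fun σ ↦ (γ σ : E4)) σ 0) σ :=
    fun σ hσ ↦ Minkowski.hasDerivAt_time (CollarCauchy.minkowski_curve hγ) hσ
  have hIcc : Icc t t₁ ⊆ s := hs.out ht ht₁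
  -- the last parameter `t₂ ∈ [t, t₁]` with `r ≤ r₊`
  set B : Set ℝ := {σ | σ ∈ Icc t t₁ ∧ Kerr.radius a (γ σ) ≤ Kerr.rPlus M a} with hB
  have hBc : IsClosed B := by
    have hcont : ContinuousOn (fun σ ↦ Kerr.radius a (γ σ)) (Icc t t₁) :=
      fun σ hσ ↦ (hrd σ (hIcc hσ)).continuousAt.continuousWithinAt
    exact hcont.preimage_isClosed_of_isClosed isClosed_Icc isClosed_Iic
  have htB : t ∈ B := ⟨⟨le_rfl, htt⟩, hle⟩
  have hBbdd : BddAbove B := ⟨t₁, fun σ hσ ↦ hσ.1.2⟩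
  obtain ⟨t₂, ht₂⟩ : ∃ t₂, t₂ = sSup B := ⟨_, rfl⟩
  have ht₂B : t₂ ∈ B := by rw [ht₂]; exact hBc.csSup_mem ⟨t, htB⟩ hBbdd
  have ht₂1 : t₂ < t₁ := by
    refine lt_of_le_of_ne ht₂B.1.2 fun h ↦ ?_
    have h' := ht₂B.2
    rw [h] at h'
    exact absurd hr₁ (not_lt.2 h')
  have hgt : ∀ σ ∈ Ioc t₂ t₁, Kerr.rPlus M a < Kerr.radius a (γ σ) := by
    intro σ hσ
    by_contra h'
    push Not at h'
    have hσB : σ ∈ B := ⟨⟨ht₂B.1.1.trans hσ.1.le, hσ.2⟩, h'⟩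
    have := le_csSup hBbdd hσB
    rw [← ht₂] at this
    exact absurd this (not_le.2 hσ.1)
  have hI2 : Icc t₂ t₁ ⊆ s := fun σ hσ ↦ hIcc ⟨ht₂B.1.1.trans hσ.1, hσ.2⟩
  -- the Lyapunov function `(r − r₊) · exp (−t*/(4M))`
  set F : ℝ → ℝ := fun σ ↦ (Kerr.radius a (γ σ) - Kerr.rPlus M a) * Real.exp (-(γ σ : E4) 0 / (4 * M))
    with hF
  have hFd : ∀ σ ∈ Icc t₂ t₁, HasDerivAt F
      (Kerr.radiusGrad a (E4.spatial (γ σ : E4)) (E4.spatial (deriv (fun σ ↦ (γ σ : E4)) σ)) *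
          Real.exp (-(γ σ : E4) 0 / (4 * M)) +
        (Kerr.radius a (γ σ) - Kerr.rPlus M a) *
          (Real.exp (-(γ σ : E4) 0 / (4 * M)) * (-deriv (fun σ ↦ (γ σ : E4)) σ 0 / (4 * M)))) σ := by
    intro σ hσ
    have h1 := (hrd σ (hI2 hσ)).sub_const (Kerr.rPlus M a)
    have h2 : HasDerivAt (fun σ ↦ Real.exp (-(γ σ : E4) 0 / (4 * M)))
        (Real.exp (-(γ σ : E4) 0 / (4 * M)) * (-deriv (fun σ ↦ (γ σ : E4)) σ 0 / (4 * M))) σ :=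
      (((htd σ (hI2 hσ)).neg).div_const (4 * M)).exp
    exact h1.mul h2
  have hanti : StrictAntiOn F (Icc t₂ t₁) := by
    refine strictAntiOn_of_deriv_neg (convex_Icc t₂ t₁)
      (fun σ hσ ↦ (hFd σ hσ).continuousAt.continuousWithinAt) fun σ hσ ↦ ?_
    rw [interior_Icc] at hσ
    have hσ' : σ ∈ Icc t₂ t₁ := Ioo_subset_Icc_self hσ
    rw [(hFd σ hσ').deriv]
    obtain ⟨-, htl, hfd⟩ := CollarCauchy.curve_velocity hγ (hI2 hσ')
    have hx : 0 < Kerr.radius a (γ σ) := Kerr.radius_pos_of_mem_region (γ σ).2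
    have hrσ : Kerr.rPlus M a < Kerr.radius a (γ σ) := hgt σ ⟨hσ.1, hσ.2.le⟩
    have hρ : 0 < Kerr.radius a (γ σ) - Kerr.rPlus M a := sub_pos.2 hrσ
    have hH := Kerr.scalarH_nonneg hM a (γ σ : E4)
    have hc : 0 < 4 * M / (Kerr.radius a (γ σ) - Kerr.rPlus M a) := div_pos (by linarith) hρ
    have hclock := CollarCauchy.clock_pos hM hx (numerator_horizon_neg ha hx hrσ) (by positivity) htl.le
      (fun h0 ↦ by rw [h0] at htl; simp at htl) hfd
    have hE : 0 < Real.exp (-(γ σ : E4) 0 / (4 * M)) := Real.exp_pos _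
    set v0 := deriv (fun σ ↦ (γ σ : E4)) σ 0 with hv0
    set dr := Kerr.radiusGrad a (E4.spatial (γ σ : E4)) (E4.spatial (deriv (fun σ ↦ (γ σ : E4)) σ)) with hdr
    set ρ := Kerr.radius a (γ σ) - Kerr.rPlus M a with hρ_def
    have h4 : 4 * M * dr < ρ * v0 := by
      have e1 : 4 * M / ρ * dr = 4 * M * dr / ρ := by ring
      rw [e1, sub_pos, div_lt_iff₀ hρ] at hclock
      linarith
    have e2 : dr * Real.exp (-(γ σ : E4) 0 / (4 * M)) +
        ρ * (Real.exp (-(γ σ : E4) 0 / (4 * M)) * (-v0 / (4 * M))) =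
        Real.exp (-(γ σ : E4) 0 / (4 * M)) * (dr - ρ * v0 / (4 * M)) := by ring
    rw [e2]
    refine mul_neg_of_pos_of_neg hE ?_
    rw [sub_neg, lt_div_iff₀ (by linarith : (0 : ℝ) < 4 * M)]
    linarith
  have h12 := hanti (left_mem_Icc.2 ht₂1.le) (right_mem_Icc.2 ht₂1.le) ht₂1
  have hF1 : 0 < F t₁ := mul_pos (sub_pos.2 hr₁) (Real.exp_pos _)
  have hF2 : F t₂ ≤ 0 := mul_nonpos_of_nonpos_of_nonneg (sub_nonpos.2 ht₂B.2) (Real.exp_pos _).le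
  linarith

end Barrier

end ExteriorTransport

open ExteriorTransport in
/-- **Registered sub-goal `stub_exteriorTransportBarrier` — the horizon barrier of the ingoing Kerr–Schild
chart.**  For sub-extremal `(M, a)`, `0 ≤ M`, and every future timelike curve `γ` of
`(Kerr.region a r₁, g_{M,a}, −g♯dt*)` on an interval `s`: if `r(γ t₁) > r₊` at some parameter `t₁ ∈ s`, then
`r(γ t) > r₊` at every earlier parameter `t ≤ t₁` of `s` — future timelike curves cannot leave the black hole
`{r ≤ r₊}`, equivalently past-directed timelike curves from the exterior never reach the future event horizon
(`ExteriorTransport.radius_gt_of_le`: the clock `dt* − (4M/(r − r₊)) dr` and the Lyapunov function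
`(r − r₊)e^{−t*/4M}`).  This is the step "along the pulled-back curve `r` stays `> r₊`" of the last-exit argument of
stub S7 `stub_exteriorTransport`. Dafermos–Rodnianski–Shlapentokh-Rothman arXiv:1402.7034, §2.2.5.
[cite: DafermosRodnianskiShlapentokhrothman2014, §2.2.5] -/
theorem stub_exteriorTransportBarrier : ∀ [Kerr.Facts] (M a r₁ : ℝ) (hM : 0 ≤ M), |a| < M →
    ∀ (γ : ℝ → Kerr.region a r₁) (s : Set ℝ), s.OrdConnected →
      (Kerr.smoothMetric M a r₁).IsFutureTimelikeCurveOn ((Kerr.timeOrientation M a r₁ hM).ofLE le_top) γ s →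
      ∀ t₁ ∈ s, Kerr.rPlus M a < Kerr.radius a (γ t₁) → ∀ t ∈ s, t ≤ t₁ →
        Kerr.rPlus M a < Kerr.radius a (γ t) :=
  fun _ _ _ _ ha γ _ hs hγ _ ht₁ hr₁ _ ht htt ↦ radius_gt_of_le (γ := γ) ha hs hγ ht₁ hr₁ ht htt

end Summit.FinalStateConjecture.FinalStateConjecture.Theorems.SwallowTheDatum.KerrShieldedSettles

end
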